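import Literature.Computability.Cryptography.RegevSamplerMachineCos
import Literature.Computability.QuantumComplexity.GRTableMach
import HarnessLib

/-!
# Regev 2009, Lemma 3.14 in machine form over an abstract level table

Topic `Literature/Computability/Cryptography`, grouping namespace `Regev2009.SamplerRegs`; the generic form of
`RegevSamplerMachineCos.lean`. There the machine bound `tvDist_machineCirc_le` of `RegevSamplerMachine.lean` is
instantiated with the Grover–Rudolph block of the concrete cosine machine `GRCosineMach.data` for the UNCLAMPED
mass table `GRMassTable.tableT`, whose accuracy needs the budget `4·4^ℓ ≤ U·S` — exponential in the unary
parameter `U` across the instances of one input length (the ratio `2^ℓ/D_t` varies by `2^{poly}`). Here the same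
two theorems are stated for the machine datum `GRTableMach.data τ` of ANY level code `τ : LevelCode`
(`GRTableMach.lean`), with the table accuracy as the hypothesis
`hT : Accurate c (τ.tab S p U ℓ) (2/2^p)`:

* `l2Norm_prod_sub_ptQsample_le_etaCos_tab` — hypothesis `hη` of the machine bound with `η = etaCos ℓ k_A p μ c`;
* `tvDist_machineCirc_le_tab` — Regev 2009, Lemma 3.14 in machine form for the block of `τ`;
* `isOracleFree_machineCirc_tab`.

The clamped table (`LevelCode.clamp`, accuracy budget `6(p+ℓ+3) ≤ U` independent of `S`,
`GRMassTable.accurate_tableTc`) is the intended instance; `LevelCode.cos` with `GRMassTable.accurate_tableT`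
recovers `RegevSamplerMachineCos`. Everything here is proved; no named fact is introduced.

## References

* O. Regev, *On lattices, learning with errors, random linear codes, and cryptography*, J. ACM 56 (2009),
  art. 34, Lemma 3.14 (proof), Lemma 3.12 (proof), §2 p. 11 [Regev2009].
* L. Grover, T. Rudolph, *Creating superpositions that correspond to efficiently integrable probability
  distributions*, arXiv:quant-ph/0208112 (2002), eq. (1)–(5) [GroverRudolph2002].
* C. H. Bennett, E. Bernstein, G. Brassard, U. Vazirani, *Strengths and weaknesses of quantum computing*,
  SIAM J. Comput. 26 (1997), Thm. 3.3, Thm. 4.14 [BennettBernsteinBrassardVazirani1997].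
-/

noncomputable section

namespace Literature.Computability.Cryptography

namespace Regev2009

namespace SamplerRegs

open Literature.Algebra.EuclideanLattices Literature.Algebra.EuclideanLattices.Regev2009
  Literature.Algebra.EuclideanLattices.Regev2009.QPart Literature.Computability.QuantumComplexity
  Literature.Computability.QuantumComplexity.GaussianCells Literature.Computability.QuantumComplexity.GroverRudolph
  Literature.Computability.QuantumComplexity.GRWord Literature.Computability.QuantumComplexity.QFTQubits
  Literature.Computability.QuantumComplexity.QFTWord Literature.Computability.QuantumComplexity.TidyBlockFn
  Literature.Computability.QuantumComplexity.QState Literature.Computability.QuantumComplexity.GRMassTable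
  Literature.Computability.QuantumComplexity.GRTableMach
  Literature.Computability.Complexity Literature.LinearAlgebra.Matrix.Berkowitz Peikert2009 Finset _root_.Matrix SamplerArith
  SamplerScale SamplerGeom SamplerWords SamplerWordFns SamplerFormats SamplerQuery CVPOracle SamplerClassical
  SamplerClassical.Layout SamplerSubst SamplerDecode _root_.Computability Module
open Literature.Computability.QuantumComplexity.GRCosineMach (pcode abs_cosA_le_one cosA_update)
open scoped Real

variable (τ : LevelCode)

/-! ### The one-block error over an accurate table -/

/-- **The hypothesis `hη` of the machine bound holds for the block of an accurate level table with
`η = etaCos`**: on the initial content (point wires blank) the product of the levels with the machine's rotations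
is within `etaCos` of the point-Gaussian state. [cite: Regev2009, Lemma 3.12 (proof) with §2 p. 11] [cite: GroverRudolph2002, eq. (1)–(5)] -/
theorem l2Norm_prod_sub_ptQsample_le_etaCos_tab {ℓ : ℕ} (S : ℚ) (p U kA np : ℕ) (hnp : (pcode ((S, (p, U)), (kA, ℓ))).length ≤ np)
    {c : ℝ} (hc0 : 0 ≤ c) (hT : Accurate (ℓ := ℓ) c (τ.tab S p U ℓ) (2 / (2 : ℝ) ^ p)) (hηc : c * (2 * 2 ^ ℓ + 1) ≤ 2)
    {μ : ℝ} (hμ0 : 0 < μ) (hδμ : 4 * (2 / (2 : ℝ) ^ p) ≤ μ) :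
    l2Norm ((List.ofFn fun j => genLevelGate (GRData.ws ℓ np (wlen τ ℓ np) (kA + 1))
          (GRBlock.R fun j y => (machineA kA (τ.tab S p U ℓ) j y : ℝ) / 2 ^ kA) j).reverse.prod *ᵥ
        basisState (GRData.init (mach τ S p U kA ℓ np hnp)) -
        ptQsample ℓ c (GRData.ws ℓ np (wlen τ ℓ np) (kA + 1)) (GRData.init (mach τ S p U kA ℓ np hnp))) ≤ etaCos ℓ kA p μ c :=
  (l2Norm_sub_le _ _ _).trans (add_le_add
    (l2Norm_prod_machineBlock_sub_qsample_le c kA (τ.tab S p U ℓ) _ hμ0 hδμ hT _ (GRData.init_ws (mach τ S p U kA ℓ np hnp)))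
    (l2Norm_qsample_sub_ptQsample_le ℓ c hc0 hηc _ _))

/-! ### The machine bound for the block of a level table -/

variable {W : ℕ} (I : LatticeInstance) {Λ : Layout W I.n} (hΛ : Λ.OK)

open Classical in
/-- **Regev 2009, Lemma 3.14 — the machine bound with the machine of a level table.** The output law of the
machine circuit built on the Grover–Rudolph block of `GRTableMach.data τ` (parameters `((S, (p, U)), (k_A, ℓ))`
on `np` parameter wires, base content `GRData.init`, erase list `GRData.eraseList`), run on the prepared
label, is within `8·√(weighted failure of the CVP family) + slack(…, etaCos)` of `intCoords_* D_{L(B), t/√2}`,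
provided the table `τ.tab S p U ℓ` is `2/2^p`-accurate for the block's Gaussian parameter `c`.
[cite: Regev2009, Lemma 3.14 (proof), Lemma 3.12 (proof), Lemma 3.3 (proof), Claim 2.9]
[cite: BennettBernsteinBrassardVazirani1997, Thm. 3.3, Thm. 4.14] [cite: GroverRudolph2002, eq. (1)] -/
theorem tvDist_machineCirc_le_tab [IsZLattice ℝ I.lattice] [NeZero I.n] (hF : Fits Λ) {t : ℝ} (ht : 0 < t)
    (hℓ1 : 1 ≤ Λ.ℓ) (hℓY : 1 ≤ Λ.ℓY) (hbc : 1 ≤ Λ.bc) (hbcR : Λ.bc ≤ Λ.ℓR)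
    (hd : Real.sqrt I.n / t ≤ minNorm (dualLattice I.lattice) / 2)
    (hd2 : 2 * Real.sqrt (finrank ℝ (EuclideanSpace ℝ (Fin I.n))) ≤ t * minNorm (dualLattice I.lattice))
    (hRmin : 2 * Real.sqrt (finrank ℝ (EuclideanSpace ℝ (Fin I.n))) * t ≤ (2 ^ Λ.ℓR : ℕ) * minNorm I.lattice)
    (hRdec : ∀ j, 2 * |t| * Real.sqrt (finrank ℝ (EuclideanSpace ℝ (Fin I.n))) * ‖Peikert2009.dualVec I j‖ ≤ ((2 ^ Λ.ℓR : ℕ) : ℝ))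
    (hfit : DT I (2 ^ Λ.ℓR) t * (Real.sqrt I.n + Ysz I Λ t) + 1 ≤ (2 : ℝ) ^ (Λ.ℓ - 1))
    {C : ℝ} (hδ : π * (2 * Real.sqrt (finrank ℝ (EuclideanSpace ℝ (Fin I.n))) * Ysz I Λ t + Ysz I Λ t ^ 2) < 1)
    (hC : Real.exp (2 * π * Bsz I Λ t * Ysz I Λ t) * (2⁻¹ : ℝ) ^ finrank ℝ (EuclideanSpace ℝ (Fin I.n)) ≤
      C * ((1 - π * (2 * Real.sqrt (finrank ℝ (EuclideanSpace ℝ (Fin I.n))) * Ysz I Λ t + Ysz I Λ t ^ 2)) *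
        (1 - banaConst ^ finrank ℝ (EuclideanSpace ℝ (Fin I.n))) * (1 - (4⁻¹ : ℝ) ^ finrank ℝ (EuclideanSpace ℝ (Fin I.n)))))
    (hC2 : C ≤ 1 / 2) (hC0 : 0 ≤ C)
    (r : ℚ) (k : ℕ) (y : List Bool) (e : ℚ) (Fq pad : List Bool)
    (hFq0 : Fq = boolPair (boolPair (stageInput (GapSVPInstance.encode (I, r)) (k + 1) y) (boolPair (encodeNat Λ.ℓR) (encodeNat Λ.bc))) [])
    (hFq : Fq.length = Λ.Lq) (huz : (zoneOf Fq ((parOf I, 2 ^ Λ.ℓR), e) pad).length = Λ.L)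
    (hyr : ∀ (Yb : Fin I.n → Fin Λ.ℓ → Bool) i, -2 ^ (Λ.ℓY - 1) ≤ ytil I (gridVec I Yb) i ∧ ytil I (gridVec I Yb) i < 2 ^ (Λ.ℓY - 1))
    (hmr : ∀ (Yb : Fin I.n → Fin Λ.ℓ → Bool), GoodT I (2 ^ Λ.ℓR) t ht.ne' (boxPt (DT I (2 ^ Λ.ℓR) t) Yb) →
      ∀ i, -2 ^ (Λ.bc - 1) ≤ -mVec I (2 ^ Λ.ℓR) (gridVec I Yb) i ∧ -mVec I (2 ^ Λ.ℓR) (gridVec I Yb) i < 2 ^ (Λ.bc - 1))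
    (Rf : UniformQCircuitFamily) (Z : SubZone Λ (Rf.family.ancillas Λ.kq)) (hZ : ∀ s, Λ.base ≤ (Z.dirt s : ℕ))
    -- the Grover–Rudolph block of the level table: the machine's parameters on `np` parameter wires
    (S : ℚ) (p U kA np : ℕ) (hnp : (pcode ((S, (p, U)), (kA, Λ.ℓ))).length ≤ np)
    {E : Fin I.n → (Fin (GRData.B Λ.ℓ np (wlen τ Λ.ℓ np) (kA + 1)) ↪ Fin W)} (hE : BlocksFit I Λ E (GRData.ws Λ.ℓ np (wlen τ Λ.ℓ np) (kA + 1)))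
    (x' : EuclideanSpace ℝ (Fin I.n)) {c : ℝ} (hc : c = 2 * π / DT I (2 ^ Λ.ℓR) t ^ 2)
    (hT : Accurate (ℓ := Λ.ℓ) c (τ.tab S p U Λ.ℓ) (2 / (2 : ℝ) ^ p)) (hηc : c * (2 * 2 ^ Λ.ℓ + 1) ≤ 2)
    {μ : ℝ} (hμ0 : 0 < μ) (hδμ : 4 * (2 / (2 : ℝ) ^ p) ≤ μ)
    (kF : ℕ) (hk : 1 ≤ kF) (hroom : Λ.base + I.n * QFTKit.qbsize Λ.ℓR kF ≤ W) :
    ((bornPMF ((machineCirc I hΛ hF Rf Z (GRTableMach.data τ S p U kA Λ.ℓ np hnp) E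
            (GRData.eraseList (mach τ S p U kA Λ.ℓ np hnp) E) kF hk hroom).runOn 0
          (basisState (boxLab E (GRData.ws Λ.ℓ np (wlen τ Λ.ℓ np) (kA + 1)) (GRData.init (mach τ S p U kA Λ.ℓ np hnp))
            (lab₀ I Λ (2 ^ Λ.ℓR) t (zoneOf Fq ((parOf I, 2 ^ Λ.ℓR), e) pad) x')
            fun _ => GRData.init (mach τ S p U kA Λ.ℓ np hnp) ∘ GRData.ws Λ.ℓ np (wlen τ Λ.ℓ np) (kA + 1))))).map
        fun z => decZ I (2 ^ Λ.ℓR) (readS (Sblk I hΛ) z)).tvDist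
      ((discreteGaussian I.lattice (t / Real.sqrt 2) 0).map I.intCoords) ≤
      8 * Real.sqrt (weightedFail Rf I r k y (Real.sqrt I.n / t)
              (dataLaw (boxSet I.n Λ.ℓ (DT I (2 ^ Λ.ℓR) t))
                (fun x => (gaussianFunction 1 x / zBox (boxSet I.n Λ.ℓ (DT I (2 ^ Λ.ℓR) t))) ^ 2) (fun _ _ => sq_nonneg _)
                (sum_boxWeight_eq_one (boxSet_nonempty I.n Λ.ℓ (DT I (2 ^ Λ.ℓR) t))) (cOf I Λ t))).toReal +
        slack I.n Λ.ℓ Λ.ℓR (kA + 1) kF (Ysz I Λ t) C (etaCos Λ.ℓ kA p μ c) := by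
  have hc0 : 0 ≤ c := by rw [hc]; positivity
  exact tvDist_machineCirc_le I hΛ hF ht hℓ1 hℓY hbc hbcR hd hd2 hRmin hRdec hfit hδ hC hC2 hC0 r k y e Fq pad hFq0 hFq huz hyr hmr
    Rf Z hZ (GRTableMach.data τ S p U kA Λ.ℓ np hnp) hE (GRData.init (mach τ S p U kA Λ.ℓ np hnp))
    (GRData.init_mem_P (mach τ S p U kA Λ.ℓ np hnp) (Nat.succ_pos kA) (abs_cosA_le_one kA (τ.tab S p U Λ.ℓ)) (cosA_update kA (τ.tab S p U Λ.ℓ)))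
    (fun _ => false) (fun _ _ => rfl) (GRData.eraseList (mach τ S p U kA Λ.ℓ np hnp) E)
    (GRData.nodup_eraseList (mach τ S p U kA Λ.ℓ np hnp) E hE.disj) (GRData.mem_eraseList_iff (mach τ S p U kA Λ.ℓ np hnp) E)
    x' hc (l2Norm_prod_sub_ptQsample_le_etaCos_tab τ S p U kA np hnp hc0 hT hηc hμ0 hδμ) kF hk hroom

/-- **The machine circuit of the block of a level table is oracle-free** (the `CVP` family being oracle-free). [cite: Regev2009, Lemma 3.14 (proof)] -/
theorem isOracleFree_machineCirc_tab (hF : Fits Λ) (Rf : UniformQCircuitFamily) (Z : SubZone Λ (Rf.family.ancillas Λ.kq))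
    (S : ℚ) (p U kA np : ℕ) (hnp : (pcode ((S, (p, U)), (kA, Λ.ℓ))).length ≤ np)
    (E : Fin I.n → (Fin (GRData.B Λ.ℓ np (wlen τ Λ.ℓ np) (kA + 1)) ↪ Fin W))
    (kF : ℕ) (hk : 1 ≤ kF) (hroom : Λ.base + I.n * QFTKit.qbsize Λ.ℓR kF ≤ W) :
    (machineCirc I hΛ hF Rf Z (GRTableMach.data τ S p U kA Λ.ℓ np hnp) E (GRData.eraseList (mach τ S p U kA Λ.ℓ np hnp) E) kF hk hroom).IsOracleFree :=
  isOracleFree_machineCirc I hΛ hF Rf Z _ E _ kF hk hroom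

end SamplerRegs

end Regev2009

end Literature.Computability.Cryptography

end
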